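import Literature.Analysis.FluidPDE.DuchonRobertLocalBalance
import Mathlib.Analysis.SpecialFunctions.SmoothTransition
import Mathlib.MeasureTheory.Integral.IntervalIntegral.FundThmCalculus
import Mathlib.Analysis.Calculus.ContDiff.Deriv
import HarnessLib

/-!
# Novack's combined longitudinal kernels with smooth shell cut-off (Novack 2024, §2 Step 2)

Topic: Analysis/FluidPDE. Support file for the discharge of the named fact
`Torus.novack2024_longAvg_balance` (`Literature.Analysis.FluidPDE.NovackLongitudinalBalance`).

M. Novack, *Scaling laws and exact results in turbulence*, Nonlinearity 37 (2024) 095002, §2,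
proves the scale-`ℓ` longitudinal balance (last:one:L:L) by running the tensor-kernel computation
of Step 2 with the radial kernels `φ_{ℓ,γ} = ℓ^{-d} φ_γ(·/ℓ)` "with gradient supported in a
neighborhood of size `γℓ` around `S^{d−1}_ℓ`" (§2, (phi:ell:gamma:def); "we do not necessarily
assume that `φ_{ℓ,γ}` integrates to `1`"), for the longitudinal tensor `T_L = ŷ ⊗ ŷ`, and
**subtracting** the transverse balance (`T_T = 1 − ŷ ⊗ ŷ`) with the kernel `ζ_{ℓ,γ}` solving the
(ODE) `∇ζ − (2y/|y|²) ζ = (2y/|y|²) φ` (display after (ODE)), so that the transverse remainder of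
(mess:one)–(mess:two) cancels; at `γ = 0` the combined kernel is ((you:ell:ell))
`M_ℓ(y) = |B_ℓ|⁻¹1_{B_ℓ} T_L − ζ_ℓ T_T`, `ζ_ℓ = |B_ℓ|⁻¹(|y|²/ℓ² − 1) 1_{B_ℓ}`, i.e.
`M_ℓ(y) = |B_ℓ|⁻¹ 1_{B_ℓ}(y) [(1 − |y|²/ℓ²) 1 + ℓ⁻² y ⊗ y]`.

This file writes down, for `γ > 0`, an explicit **smooth** realisation of the combined kernel
`M_{ℓ,γ} = φ_{ℓ,γ} T_L − ζ_{ℓ,γ} T_T` and proves the structural properties consumed by the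
matrix-kernel facts of `Literature.Analysis.FluidPDE.NovackMatrixKernel` (smooth, even,
symmetric, divergence a gradient). With the squared-radius profile
`χ_{ℓ,γ}(s) = S((1 − s/ℓ²)/γ)` (`S = Real.smoothTransition`; `χ = 1` for `s ≤ ℓ²(1−γ)`, `χ = 0`
for `s ≥ ℓ²`), its tail primitive `P_{ℓ,γ}(s) = ∫ₛ^{ℓ²} χ_{ℓ,γ}` and `c_ℓ = (|B_ℓ| ℓ²)⁻¹`:

* `φ_{ℓ,γ}(y) = c_ℓ (P(|y|²) + |y|² χ(|y|²))` is radial, nonnegative, constant on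
  `|y| ≤ ℓ√(1−γ)`, vanishes for `|y| ≥ ℓ`, has `∇φ_{ℓ,γ} = 2c_ℓ χ'(|y|²)|y|² y` supported in the
  shell, and `φ_{ℓ,γ} → |B_ℓ|⁻¹ 1_{B_ℓ}` as `γ → 0`;
* `ζ_{ℓ,γ}(y) = −c_ℓ P(|y|²)` solves Novack's (ODE) with this `φ`
  (`∇ζ − (2y/|y|²)ζ = 2c_ℓ(χ + P/|y|²) y = (2y/|y|²) φ_{ℓ,γ}`) and `ζ_{ℓ,γ} → ζ_ℓ`;
* the combined kernel has the manifestly smooth entries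
  `M_{ℓ,γ}^{ij}(y) = φ T_L^{ij} − ζ T_T^{ij} = c_ℓ [P(|y|²) δᵢⱼ + χ(|y|²) yᵢ yⱼ]`
  (`Torus.novackKernelE`; `(φ + ζ) ŷᵢŷⱼ − ζ δᵢⱼ` with `φ + ζ = c_ℓ|y|²χ`), periodised onto `T^d` as
  `Torus.novackKernel ℓ γ i j` (`Torus.periodize`; for `ℓ < 1/2` at most one lattice term);
* its divergence is the gradient of the potential
  `ζ̃_{ℓ,γ}(y) = c_ℓ [|y|² χ(|y|²) − ((d−3)/2) P(|y|²)]` (`Torus.novackPotentialE`,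
  `Torus.novackPotential`): `∑ᵢ ∂ᵢ M^{ij} = c_ℓ yⱼ [(d−1)χ + 2|y|²χ'] = ∂ⱼ ζ̃` (Novack's
  `∂ᵢ(T^{ik} φ) = ∂ₖ ζ̃`, first display of Step 2); as `γ → 0`,
  `ζ̃_{ℓ,γ} → |B_ℓ|⁻¹[1 − ((d−1)/2)(1 − |y|²/ℓ²)] 1_{B_ℓ}`, the kernel of `Torus.longAvgPressure`.

Proved here: smoothness (`contDiff_novackKernelE`, `isSmooth_novackKernel`,
`isSmooth_novackPotential`), support in `closedBall 0 ℓ`, evenness and symmetry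
(`novackKernel_neg`, `novackKernel_comm`, `novackPotential_neg`), and the potential identity on
`ℝ^d` (`sum_fderiv_novackKernelE`) and on `T^d` (`sum_partialDeriv_novackKernel`).

## Design notes

* The profile is taken in the squared radius so that no `|y|`-singularity at the origin has
  to be excised (Novack's cut-off `c_{κ,•}` and the limit `κ → 0`, (withkappa), are not needed
  for the combined kernel: `φ T_L − ζ T_T` is smooth at `0` because `φ + ζ = c_ℓ|y|²χ` vanishes
  to second order).
* The order of Novack's two limits is exchanged in the discharge: the kernels are combined at
  `γ > 0` and `γ → 0` is taken once, in the combined balance (`NovackLongitudinalBalanceSteps`);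
  all identities being linear in the kernel, this is the printed argument re-bracketed.
* Junk: for `γ ≤ 0` the profile is not compactly supported and the periodisation is junk; every
  lemma assumes `0 < γ` (and `0 < ℓ`).

## References

* M. Novack, *Scaling laws and exact results in turbulence*, Nonlinearity 37 (2024) 095002,
  arXiv:2310.01375: §2 (phi:ell:gamma:def), Step 2 (potentials `ζ̃`, (ODE) and the display
  after it, (you:ell:ell)). [Novack2024]
-/

noncomputable section

open MeasureTheory TopologicalSpace Set Function Filter Metric
open _root_.Topology
open scoped ENNReal NNReal ContDiff InnerProductSpace RealInnerProductSpace

namespace Literature.Analysis.FluidPDE.Torus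

variable {d : Type*} [Fintype d] [DecidableEq d]

/-! ## The shell cut-off profile and its tail primitive -/

section Profile

/-- **The shell cut-off in the squared radius**, `χ_{ℓ,γ}(s) = S((1 − s/ℓ²)/γ)` with
`S = Real.smoothTransition`: smooth, `= 1` for `s ≤ ℓ²(1−γ)`, `= 0` for `s ≥ ℓ²`, non-increasing
(the radial profile of Novack's `φ_γ`, "gradient supported in a `γ`-neighborhood around the sphere
of radius `1`", read in `s = |y|²/ℓ²`). [cite: Novack2024, Sect. 2 (phi:ell:gamma:def)] -/
def novackCutoff (ℓ γ s : ℝ) : ℝ :=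
  Real.smoothTransition ((1 - s / ℓ ^ 2) / γ)

/-- **The tail primitive** `P_{ℓ,γ}(s) = ∫ₛ^{ℓ²} χ_{ℓ,γ}(σ) dσ` of the shell cut-off (so that
`P' = −χ`, `P = 0` for `s ≥ ℓ²`; `c_ℓ P(|y|²) = −ζ_{ℓ,γ}(y)` is minus Novack's transverse kernel). [cite: Novack2024, Sect. 2 Step 2 (ODE)] -/
def novackCutoffPrim (ℓ γ s : ℝ) : ℝ :=
  ∫ σ in s..ℓ ^ 2, novackCutoff ℓ γ σ

variable {ℓ γ : ℝ}

/-- The shell cut-off is smooth. [folklore] -/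
theorem contDiff_novackCutoff (ℓ γ : ℝ) : ContDiff ℝ ∞ (novackCutoff ℓ γ) :=
  Real.smoothTransition.contDiff.comp ((contDiff_const.sub (contDiff_id.div_const _)).div_const _)

/-- The shell cut-off is continuous. [folklore] -/
theorem continuous_novackCutoff (ℓ γ : ℝ) : Continuous (novackCutoff ℓ γ) :=
  (contDiff_novackCutoff ℓ γ).continuous

/-- The shell cut-off takes values in `[0, 1]`. [folklore] -/
theorem novackCutoff_mem_Icc (ℓ γ s : ℝ) : novackCutoff ℓ γ s ∈ Icc (0 : ℝ) 1 :=
  ⟨Real.smoothTransition.nonneg _, Real.smoothTransition.le_one _⟩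

/-- The shell cut-off vanishes outside the ball: `χ_{ℓ,γ}(s) = 0` for `s ≥ ℓ²` (`ℓ ≠ 0`, `γ > 0`). [folklore] -/
theorem novackCutoff_eq_zero (hℓ : ℓ ≠ 0) (hγ : 0 < γ) {s : ℝ} (hs : ℓ ^ 2 ≤ s) :
    novackCutoff ℓ γ s = 0 := by
  refine Real.smoothTransition.zero_of_nonpos (div_nonpos_of_nonpos_of_nonneg ?_ hγ.le)
  have hℓ2 : 0 < ℓ ^ 2 := by positivity
  rw [sub_nonpos, le_div_iff₀ hℓ2, one_mul]
  exact hs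

/-- The shell cut-off is `1` on the inner ball: `χ_{ℓ,γ}(s) = 1` for `s ≤ ℓ²(1 − γ)` (`ℓ ≠ 0`,
`γ > 0`). [folklore] -/
theorem novackCutoff_eq_one (hℓ : ℓ ≠ 0) (hγ : 0 < γ) {s : ℝ} (hs : s ≤ ℓ ^ 2 * (1 - γ)) :
    novackCutoff ℓ γ s = 1 := by
  refine Real.smoothTransition.one_of_one_le ?_
  have hℓ2 : 0 < ℓ ^ 2 := by positivity
  rw [le_div_iff₀ hγ, one_mul, le_sub_comm, div_le_iff₀ hℓ2]
  linarith

/-- The tail primitive has derivative `−χ`: `P' (s) = −χ_{ℓ,γ}(s)`. [folklore] -/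
theorem hasDerivAt_novackCutoffPrim (ℓ γ s : ℝ) :
    HasDerivAt (novackCutoffPrim ℓ γ) (-novackCutoff ℓ γ s) s :=
  intervalIntegral.integral_hasDerivAt_left
    ((continuous_novackCutoff ℓ γ).intervalIntegrable _ _)
    ((continuous_novackCutoff ℓ γ).stronglyMeasurableAtFilter _ _)
    (continuous_novackCutoff ℓ γ).continuousAt

/-- `deriv P = −χ`. [folklore] -/
theorem deriv_novackCutoffPrim (ℓ γ : ℝ) :
    deriv (novackCutoffPrim ℓ γ) = fun s => -novackCutoff ℓ γ s :=
  funext fun s => (hasDerivAt_novackCutoffPrim ℓ γ s).deriv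

/-- The tail primitive is smooth. [folklore] -/
theorem contDiff_novackCutoffPrim (ℓ γ : ℝ) : ContDiff ℝ ∞ (novackCutoffPrim ℓ γ) := by
  rw [contDiff_infty_iff_deriv, deriv_novackCutoffPrim]
  exact ⟨fun s => (hasDerivAt_novackCutoffPrim ℓ γ s).differentiableAt,
    (contDiff_novackCutoff ℓ γ).neg⟩

/-- The tail primitive vanishes outside the ball: `P(s) = 0` for `s ≥ ℓ²`. [folklore] -/
theorem novackCutoffPrim_eq_zero (hℓ : ℓ ≠ 0) (hγ : 0 < γ) {s : ℝ} (hs : ℓ ^ 2 ≤ s) :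
    novackCutoffPrim ℓ γ s = 0 := by
  rw [novackCutoffPrim, intervalIntegral.integral_symm, neg_eq_zero]
  refine intervalIntegral.integral_zero_ae (ae_of_all _ fun σ hσ => ?_)
  rw [uIoc_of_le hs] at hσ
  exact novackCutoff_eq_zero hℓ hγ hσ.1.le

/-- The tail primitive is nonnegative. [folklore] -/
theorem novackCutoffPrim_nonneg (ℓ γ s : ℝ) (hs : s ≤ ℓ ^ 2) : 0 ≤ novackCutoffPrim ℓ γ s :=
  intervalIntegral.integral_nonneg hs fun σ _ => (novackCutoff_mem_Icc ℓ γ σ).1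

end Profile

/-! ## The combined kernel and its potential on `ℝ^d` -/

section Euclidean

variable (d) in
/-- The normalising constant `c_ℓ = (|B_ℓ| ℓ²)⁻¹` of the combined kernel
(`|B_ℓ|` the Lebesgue measure of the ball of radius `ℓ` in `ℝ^d`). [cite: Novack2024, Sect. 2 Step 2 (you:ell:ell)] -/
def novackKernelConst (ℓ : ℝ) : ℝ :=
  ((volume (ball (0 : EuclideanSpace ℝ d) ℓ)).toReal * ℓ ^ 2)⁻¹

/-- **Novack's combined longitudinal kernel with smooth shell cut-off**, entry `(i, j)`, on `ℝ^d`: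
`M_{ℓ,γ}^{ij}(y) = φ_{ℓ,γ}(y) T_L^{ij}(y) − ζ_{ℓ,γ}(y) T_T^{ij}(y) = c_ℓ [P_{ℓ,γ}(|y|²) δᵢⱼ + χ_{ℓ,γ}(|y|²) yᵢ yⱼ]`
with `φ_{ℓ,γ} = c_ℓ(P + |y|²χ)`, `ζ_{ℓ,γ} = −c_ℓ P` (Novack 2024, §2 Step 2: the kernel
`|B_ℓ|⁻¹1_{B_ℓ} T_L − ζ_ℓ T_T` of (you:ell:ell) at cut-off width `γ > 0`; as `γ → 0`,
`M_{ℓ,γ} → |B_ℓ|⁻¹1_{B_ℓ}[(1 − |y|²/ℓ²) 1 + ℓ⁻² y ⊗ y]`). [cite: Novack2024, Sect. 2 Step 2 (you:ell:ell)] -/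
def novackKernelE (ℓ γ : ℝ) (i j : d) (y : EuclideanSpace ℝ d) : ℝ :=
  novackKernelConst d ℓ *
    (novackCutoffPrim ℓ γ (‖y‖ ^ 2) * (if i = j then 1 else 0) + novackCutoff ℓ γ (‖y‖ ^ 2) * (y i * y j))

variable (d) in
/-- **The pressure potential of the combined kernel** on `ℝ^d`:
`ζ̃_{ℓ,γ}(y) = c_ℓ [|y|² χ_{ℓ,γ}(|y|²) − ((d−3)/2) P_{ℓ,γ}(|y|²)]`, the compactly supported solution
of `∂ᵢ M_{ℓ,γ}^{ij} = ∂ⱼ ζ̃_{ℓ,γ}` (Novack 2024, §2 Step 2, first display: `∂ᵢ(T^{ik}_• φ) = ∂ₖ ζ̃_•`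
"are gradients of potentials"; `p_{L,ℓ} = p ⋆ ζ̃` is "defined analogously"). [cite: Novack2024, Sect. 2 Step 2, potentials ζ̃] -/
def novackPotentialE (ℓ γ : ℝ) (y : EuclideanSpace ℝ d) : ℝ :=
  novackKernelConst d ℓ *
    (‖y‖ ^ 2 * novackCutoff ℓ γ (‖y‖ ^ 2) -
      ((Fintype.card d : ℝ) - 3) / 2 * novackCutoffPrim ℓ γ (‖y‖ ^ 2))

variable {ℓ γ : ℝ}

omit [DecidableEq d] in
/-- `y ↦ F(|y|²)` is smooth for smooth `F`. [folklore] -/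
theorem contDiff_comp_norm_sq {F : ℝ → ℝ} (hF : ContDiff ℝ ∞ F) :
    ContDiff ℝ ∞ fun y : EuclideanSpace ℝ d => F (‖y‖ ^ 2) :=
  hF.comp (contDiff_norm_sq ℝ)

/-- The entries of the combined kernel are smooth on `ℝ^d`. [folklore] -/
theorem contDiff_novackKernelE (ℓ γ : ℝ) (i j : d) : ContDiff ℝ ∞ (novackKernelE ℓ γ i j) := by
  unfold novackKernelE
  refine contDiff_const.mul ((((contDiff_comp_norm_sq (contDiff_novackCutoffPrim ℓ γ)).mul
    contDiff_const)).add ((contDiff_comp_norm_sq (contDiff_novackCutoff ℓ γ)).mul ?_))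
  exact ((EuclideanSpace.proj (𝕜 := ℝ) i).contDiff).mul ((EuclideanSpace.proj (𝕜 := ℝ) j).contDiff)

omit [DecidableEq d] in
/-- The potential is smooth on `ℝ^d`. [folklore] -/
theorem contDiff_novackPotentialE (ℓ γ : ℝ) : ContDiff ℝ ∞ (novackPotentialE d ℓ γ) := by
  unfold novackPotentialE
  exact contDiff_const.mul (((contDiff_norm_sq ℝ).mul
    (contDiff_comp_norm_sq (contDiff_novackCutoff ℓ γ))).sub
    (contDiff_const.mul (contDiff_comp_norm_sq (contDiff_novackCutoffPrim ℓ γ))))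

/-- The combined kernel vanishes outside the closed ball of radius `ℓ`. [folklore] -/
theorem novackKernelE_eq_zero (hℓ : 0 < ℓ) (hγ : 0 < γ) (i j : d) {y : EuclideanSpace ℝ d}
    (hy : ℓ ≤ ‖y‖) : novackKernelE ℓ γ i j y = 0 := by
  have hs : ℓ ^ 2 ≤ ‖y‖ ^ 2 := by gcongr
  rw [novackKernelE, novackCutoffPrim_eq_zero hℓ.ne' hγ hs, novackCutoff_eq_zero hℓ.ne' hγ hs]
  ring

omit [DecidableEq d] in
/-- The potential vanishes outside the closed ball of radius `ℓ`. [folklore] -/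
theorem novackPotentialE_eq_zero (hℓ : 0 < ℓ) (hγ : 0 < γ) {y : EuclideanSpace ℝ d}
    (hy : ℓ ≤ ‖y‖) : novackPotentialE d ℓ γ y = 0 := by
  have hs : ℓ ^ 2 ≤ ‖y‖ ^ 2 := by gcongr
  rw [novackPotentialE, novackCutoffPrim_eq_zero hℓ.ne' hγ hs, novackCutoff_eq_zero hℓ.ne' hγ hs]
  ring

omit [DecidableEq d] in
/-- A function on `ℝ^d` vanishing for `‖y‖ ≥ ℓ` has topological support in the closed ball of
radius `ℓ`. [folklore] -/
theorem tsupport_subset_closedBall_of_eq_zero {g : EuclideanSpace ℝ d → ℝ}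
    (hg : ∀ y, ℓ ≤ ‖y‖ → g y = 0) : tsupport g ⊆ closedBall 0 ℓ := by
  refine closure_minimal (fun y hy => ?_) isClosed_closedBall
  rw [mem_closedBall, dist_zero_right]
  by_contra h
  exact hy (hg y (not_le.1 h).le)

/-- The combined kernel is supported in the closed ball of radius `ℓ`. [folklore] -/
theorem tsupport_novackKernelE_subset (hℓ : 0 < ℓ) (hγ : 0 < γ) (i j : d) :
    tsupport (novackKernelE ℓ γ i j) ⊆ closedBall 0 ℓ :=
  tsupport_subset_closedBall_of_eq_zero fun _ hy => novackKernelE_eq_zero hℓ hγ i j hy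

omit [DecidableEq d] in
/-- The potential is supported in the closed ball of radius `ℓ`. [folklore] -/
theorem tsupport_novackPotentialE_subset (hℓ : 0 < ℓ) (hγ : 0 < γ) :
    tsupport (novackPotentialE d ℓ γ) ⊆ closedBall 0 ℓ :=
  tsupport_subset_closedBall_of_eq_zero fun _ hy => novackPotentialE_eq_zero hℓ hγ hy

/-- The combined kernel is even: `M_{ℓ,γ}^{ij}(−y) = M_{ℓ,γ}^{ij}(y)` ("radially symmetric"). [folklore] -/
theorem novackKernelE_neg (ℓ γ : ℝ) (i j : d) (y : EuclideanSpace ℝ d) :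
    novackKernelE ℓ γ i j (-y) = novackKernelE ℓ γ i j y := by
  simp only [novackKernelE, norm_neg, PiLp.neg_apply, neg_mul_neg]

/-- The combined kernel is symmetric: `M^{ij} = M^{ji}` ("symmetric tensors"). [folklore] -/
theorem novackKernelE_comm (ℓ γ : ℝ) (i j : d) : novackKernelE ℓ γ i j = novackKernelE ℓ γ j i := by
  funext y
  simp only [novackKernelE, mul_comm (y i) (y j), eq_comm (a := i) (b := j)]

omit [DecidableEq d] in
/-- The potential is even. [folklore] -/
theorem novackPotentialE_neg (ℓ γ : ℝ) (y : EuclideanSpace ℝ d) :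
    novackPotentialE d ℓ γ (-y) = novackPotentialE d ℓ γ y := by
  simp only [novackPotentialE, norm_neg]

end Euclidean

/-! ## The divergence of the combined kernel is the gradient of the potential (on `ℝ^d`) -/

section PotentialIdentity

variable {ℓ γ : ℝ}

/-- The Fréchet derivative of an entry of the combined kernel, evaluated on a basis vector:
`∂ₖ M^{ij}(y) = c_ℓ [−2χ(|y|²) yₖ δᵢⱼ + χ(|y|²)(δᵢₖ yⱼ + yᵢ δⱼₖ) + 2χ'(|y|²) yₖ yᵢ yⱼ]`. [folklore] -/
theorem fderiv_novackKernelE_apply_single (ℓ γ : ℝ) (i j k : d) (y : EuclideanSpace ℝ d) :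
    fderiv ℝ (novackKernelE ℓ γ i j) y (EuclideanSpace.single k 1) =
      novackKernelConst d ℓ *
        ((if i = j then 1 else 0) * (-(2 * novackCutoff ℓ γ (‖y‖ ^ 2) * y k)) +
          (novackCutoff ℓ γ (‖y‖ ^ 2) * ((if i = k then 1 else 0) * y j + y i * (if j = k then 1 else 0)) +
            y i * y j * (2 * deriv (novackCutoff ℓ γ) (‖y‖ ^ 2) * y k))) := by
  set χ := novackCutoff ℓ γ with hχ
  set P := novackCutoffPrim ℓ γ with hP
  have hN : HasFDerivAt (fun x : EuclideanSpace ℝ d => ‖x‖ ^ 2) (2 • innerSL ℝ y) y :=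
    (hasStrictFDerivAt_norm_sq y).hasFDerivAt
  have hPN : HasFDerivAt (fun x : EuclideanSpace ℝ d => P (‖x‖ ^ 2))
      ((-χ (‖y‖ ^ 2)) • (2 • innerSL ℝ y)) y :=
    HasDerivAt.comp_hasFDerivAt (h₂ := P) (f := fun x : EuclideanSpace ℝ d => ‖x‖ ^ 2) y
      (hasDerivAt_novackCutoffPrim ℓ γ (‖y‖ ^ 2)) hN
  have hχd : HasDerivAt χ (deriv χ (‖y‖ ^ 2)) (‖y‖ ^ 2) :=
    (((contDiff_novackCutoff ℓ γ).differentiable (by simp)) _).hasDerivAt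
  have hχN : HasFDerivAt (fun x : EuclideanSpace ℝ d => χ (‖x‖ ^ 2))
      ((deriv χ (‖y‖ ^ 2)) • (2 • innerSL ℝ y)) y :=
    HasDerivAt.comp_hasFDerivAt (h₂ := χ) (f := fun x : EuclideanSpace ℝ d => ‖x‖ ^ 2) y hχd hN
  have hπ : ∀ m : d, HasFDerivAt (fun x : EuclideanSpace ℝ d => x m)
      (EuclideanSpace.proj m : EuclideanSpace ℝ d →L[ℝ] ℝ) y := fun m =>
    (EuclideanSpace.proj (𝕜 := ℝ) m).hasFDerivAt
  have hπij : HasFDerivAt (fun x : EuclideanSpace ℝ d => x i * x j)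
      (y i • (EuclideanSpace.proj j : EuclideanSpace ℝ d →L[ℝ] ℝ) +
        y j • (EuclideanSpace.proj i : EuclideanSpace ℝ d →L[ℝ] ℝ)) y := (hπ i).mul (hπ j)
  have h1 : HasFDerivAt (fun x : EuclideanSpace ℝ d => P (‖x‖ ^ 2) * (if i = j then (1 : ℝ) else 0))
      ((if i = j then (1 : ℝ) else 0) • ((-χ (‖y‖ ^ 2)) • (2 • innerSL ℝ y))) y :=
    hPN.mul_const _
  have h2 : HasFDerivAt (fun x : EuclideanSpace ℝ d => χ (‖x‖ ^ 2) * (x i * x j))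
      (χ (‖y‖ ^ 2) • (y i • (EuclideanSpace.proj j : EuclideanSpace ℝ d →L[ℝ] ℝ) +
          y j • (EuclideanSpace.proj i : EuclideanSpace ℝ d →L[ℝ] ℝ)) +
        (y i * y j) • ((deriv χ (‖y‖ ^ 2)) • (2 • innerSL ℝ y))) y :=
    hχN.mul hπij
  have h : HasFDerivAt (novackKernelE ℓ γ i j)
      (novackKernelConst d ℓ • (((if i = j then (1 : ℝ) else 0) • ((-χ (‖y‖ ^ 2)) • (2 • innerSL ℝ y))) +
        (χ (‖y‖ ^ 2) • (y i • (EuclideanSpace.proj j : EuclideanSpace ℝ d →L[ℝ] ℝ) +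
          y j • (EuclideanSpace.proj i : EuclideanSpace ℝ d →L[ℝ] ℝ)) +
        (y i * y j) • ((deriv χ (‖y‖ ^ 2)) • (2 • innerSL ℝ y))))) y := by
    have := (h1.add h2).const_mul (novackKernelConst d ℓ)
    exact this
  rw [h.fderiv]
  simp only [smul_apply, add_apply, innerSL_apply_apply,
    EuclideanSpace.inner_single_right, PiLp.proj_apply, PiLp.single_apply, smul_eq_mul,
    conj_trivial]
  ring

omit [DecidableEq d] in
/-- The Fréchet derivative of the potential, evaluated on a basis vector:
`∂ⱼ ζ̃(y) = c_ℓ [2χ yⱼ + 2|y|²χ' yⱼ + (d−3) χ yⱼ]`. [folklore] -/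
theorem fderiv_novackPotentialE_apply_single [DecidableEq d] (ℓ γ : ℝ) (j : d)
    (y : EuclideanSpace ℝ d) :
    fderiv ℝ (novackPotentialE d ℓ γ) y (EuclideanSpace.single j 1) =
      novackKernelConst d ℓ *
        (2 * y j * novackCutoff ℓ γ (‖y‖ ^ 2) +
            ‖y‖ ^ 2 * (2 * deriv (novackCutoff ℓ γ) (‖y‖ ^ 2) * y j) -
          ((Fintype.card d : ℝ) - 3) / 2 * (-(2 * novackCutoff ℓ γ (‖y‖ ^ 2) * y j))) := by
  set χ := novackCutoff ℓ γ with hχ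
  set P := novackCutoffPrim ℓ γ with hP
  have hN : HasFDerivAt (fun x : EuclideanSpace ℝ d => ‖x‖ ^ 2) (2 • innerSL ℝ y) y :=
    (hasStrictFDerivAt_norm_sq y).hasFDerivAt
  have hPN : HasFDerivAt (fun x : EuclideanSpace ℝ d => P (‖x‖ ^ 2))
      ((-χ (‖y‖ ^ 2)) • (2 • innerSL ℝ y)) y :=
    HasDerivAt.comp_hasFDerivAt (h₂ := P) (f := fun x : EuclideanSpace ℝ d => ‖x‖ ^ 2) y
      (hasDerivAt_novackCutoffPrim ℓ γ (‖y‖ ^ 2)) hN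
  have hχd : HasDerivAt χ (deriv χ (‖y‖ ^ 2)) (‖y‖ ^ 2) :=
    (((contDiff_novackCutoff ℓ γ).differentiable (by simp)) _).hasDerivAt
  have hχN : HasFDerivAt (fun x : EuclideanSpace ℝ d => χ (‖x‖ ^ 2))
      ((deriv χ (‖y‖ ^ 2)) • (2 • innerSL ℝ y)) y :=
    HasDerivAt.comp_hasFDerivAt (h₂ := χ) (f := fun x : EuclideanSpace ℝ d => ‖x‖ ^ 2) y hχd hN
  have h1 : HasFDerivAt (fun x : EuclideanSpace ℝ d => ‖x‖ ^ 2 * χ (‖x‖ ^ 2))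
      (‖y‖ ^ 2 • ((deriv χ (‖y‖ ^ 2)) • (2 • innerSL ℝ y)) + χ (‖y‖ ^ 2) • (2 • innerSL ℝ y)) y :=
    hN.mul hχN
  have h2 : HasFDerivAt (fun x : EuclideanSpace ℝ d =>
      ((Fintype.card d : ℝ) - 3) / 2 * P (‖x‖ ^ 2))
      ((((Fintype.card d : ℝ) - 3) / 2) • ((-χ (‖y‖ ^ 2)) • (2 • innerSL ℝ y))) y :=
    hPN.const_mul _
  have h : HasFDerivAt (novackPotentialE d ℓ γ)
      (novackKernelConst d ℓ • ((‖y‖ ^ 2 • ((deriv χ (‖y‖ ^ 2)) • (2 • innerSL ℝ y)) +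
        χ (‖y‖ ^ 2) • (2 • innerSL ℝ y)) -
        (((Fintype.card d : ℝ) - 3) / 2) • ((-χ (‖y‖ ^ 2)) • (2 • innerSL ℝ y)))) y := by
    have := (h1.sub h2).const_mul (novackKernelConst d ℓ)
    exact this
  rw [h.fderiv]
  simp only [smul_apply, add_apply, sub_apply, innerSL_apply_apply,
    EuclideanSpace.inner_single_right, smul_eq_mul, conj_trivial]
  ring

/-- **The divergence of the combined kernel is the gradient of its potential** (Novack 2024, §2
Step 2, first display: `∂ᵢ(T^{ik}_• φ_{ℓ,γ,κ,•}) = ∂ₖ ζ̃`): on `ℝ^d`,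
`∑ᵢ ∂ᵢ M_{ℓ,γ}^{ij}(y) = c_ℓ yⱼ[(d−1)χ(|y|²) + 2|y|²χ'(|y|²)] = ∂ⱼ ζ̃_{ℓ,γ}(y)`. [cite: Novack2024, Sect. 2 Step 2, potentials ζ̃] -/
theorem sum_fderiv_novackKernelE (ℓ γ : ℝ) (j : d) (y : EuclideanSpace ℝ d) :
    ∑ i, fderiv ℝ (novackKernelE ℓ γ i j) y (EuclideanSpace.single i 1) =
      fderiv ℝ (novackPotentialE d ℓ γ) y (EuclideanSpace.single j 1) := by
  have hsq : ∑ i, y i * y i = ‖y‖ ^ 2 := by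
    rw [EuclideanSpace.real_norm_sq_eq]
    exact Finset.sum_congr rfl fun i _ => by ring
  set χ0 := novackCutoff ℓ γ (‖y‖ ^ 2) with hχ0
  set χ1 := deriv (novackCutoff ℓ γ) (‖y‖ ^ 2) with hχ1
  set c := novackKernelConst d ℓ with hc
  have key : ∀ i, fderiv ℝ (novackKernelE ℓ γ i j) y (EuclideanSpace.single i 1) =
      c * (-(2 * χ0)) * (if i = j then y i else 0) + c * (χ0 * y j) +
        c * χ0 * (if j = i then y i else 0) + c * (2 * χ1 * y j) * (y i * y i) := by
    intro i
    rw [fderiv_novackKernelE_apply_single]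
    by_cases hij : i = j
    · subst hij
      simp only [if_true]
      ring
    · have hji : ¬ j = i := fun h => hij h.symm
      simp only [hij, hji, if_false, if_true]
      ring
  have e1 : ∑ i, c * (-(2 * χ0)) * (if i = j then y i else 0) = c * (-(2 * χ0)) * y j := by
    rw [← Finset.mul_sum, Finset.sum_ite_eq']
    simp
  have e2 : ∑ _i : d, c * (χ0 * y j) = (Fintype.card d : ℝ) * (c * (χ0 * y j)) := by
    rw [Finset.sum_const, Finset.card_univ, nsmul_eq_mul]
  have e3 : ∑ i, c * χ0 * (if j = i then y i else 0) = c * χ0 * y j := by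
    rw [← Finset.mul_sum, Finset.sum_ite_eq]
    simp
  have e4 : ∑ i, c * (2 * χ1 * y j) * (y i * y i) = c * (2 * χ1 * y j) * ‖y‖ ^ 2 := by
    rw [← Finset.mul_sum, hsq]
  rw [Finset.sum_congr rfl fun i _ => key i, Finset.sum_add_distrib, Finset.sum_add_distrib,
    Finset.sum_add_distrib, e1, e2, e3, e4, fderiv_novackPotentialE_apply_single]
  ring

end PotentialIdentity

/-! ## The periodised kernels on `T^d` -/

section TorusKernel

/-- **Novack's combined longitudinal kernel on the torus**, entry `(i, j)`: the periodisation
`∑_{k ∈ ℤ^d} M_{ℓ,γ}^{ij}(· + k)` of `novackKernelE ℓ γ i j` (`Torus.periodize`; for `ℓ < 1/2`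
the lattice translates have disjoint supports). Meaningful for `0 < ℓ`, `0 < γ`. [cite: Novack2024, Sect. 2 Step 2 (you:ell:ell)] -/
def novackKernel (ℓ γ : ℝ) (i j : d) : UnitAddTorus d → ℝ :=
  FunctionSpaces.Torus.periodize (novackKernelE ℓ γ i j)

variable (d) in
/-- **The pressure potential of the combined kernel on the torus**: the periodisation of
`novackPotentialE d ℓ γ`. [cite: Novack2024, Sect. 2 Step 2, potentials ζ̃] -/
def novackPotential (ℓ γ : ℝ) : UnitAddTorus d → ℝ :=
  FunctionSpaces.Torus.periodize (novackPotentialE d ℓ γ)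

variable {ℓ γ : ℝ}

/-- Unfolding `novackKernel`. [folklore] -/
theorem novackKernel_apply (ℓ γ : ℝ) (i j : d) (x : UnitAddTorus d) :
    novackKernel ℓ γ i j x =
      FunctionSpaces.Torus.perSum (novackKernelE ℓ γ i j) (FunctionSpaces.Torus.repr x) :=
  rfl

/-- Unfolding `novackPotential`. [folklore] -/
theorem novackPotential_apply (ℓ γ : ℝ) (x : UnitAddTorus d) :
    novackPotential d ℓ γ x =
      FunctionSpaces.Torus.perSum (novackPotentialE d ℓ γ) (FunctionSpaces.Torus.repr x) :=
  rfl

/-- The torus kernel is smooth (`0 < ℓ`, `0 < γ`). [folklore] -/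
theorem isSmooth_novackKernel (hℓ : 0 < ℓ) (hγ : 0 < γ) (i j : d) :
    FunctionSpaces.Torus.IsSmooth (novackKernel ℓ γ i j) :=
  FunctionSpaces.Torus.isSmooth_periodize (contDiff_novackKernelE ℓ γ i j)
    (tsupport_novackKernelE_subset hℓ hγ i j)

/-- The torus potential is smooth (`0 < ℓ`, `0 < γ`). [folklore] -/
theorem isSmooth_novackPotential (hℓ : 0 < ℓ) (hγ : 0 < γ) :
    FunctionSpaces.Torus.IsSmooth (novackPotential d ℓ γ) :=
  FunctionSpaces.Torus.isSmooth_periodize (contDiff_novackPotentialE ℓ γ)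
    (tsupport_novackPotentialE_subset hℓ hγ)

/-- The periodisation of an even function is even on the torus. [folklore] -/
theorem periodize_neg_of_even {g : EuclideanSpace ℝ d → ℝ} (hg : ∀ ξ, g (-ξ) = g ξ)
    (z : UnitAddTorus d) :
    FunctionSpaces.Torus.periodize g (-z) = FunctionSpaces.Torus.periodize g z := by
  rw [FunctionSpaces.Torus.periodize_apply, FunctionSpaces.Torus.periodize_apply]
  have h1 : FunctionSpaces.Torus.repr (-z) =
      FunctionSpaces.Torus.repr (FunctionSpaces.Torus.proj (-FunctionSpaces.Torus.repr z)) := by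
    rw [FunctionSpaces.Torus.proj_neg, FunctionSpaces.Torus.proj_repr]
  rw [h1, FunctionSpaces.Torus.perSum_repr_proj, perSum_neg_of_even hg]

/-- The torus kernel is **even**: `M^{ij}(−z) = M^{ij}(z)`. [folklore] -/
theorem novackKernel_neg (ℓ γ : ℝ) (i j : d) (z : UnitAddTorus d) :
    novackKernel ℓ γ i j (-z) = novackKernel ℓ γ i j z :=
  periodize_neg_of_even (novackKernelE_neg ℓ γ i j) z

/-- The torus kernel is **symmetric**: `M^{ij} = M^{ji}`. [folklore] -/
theorem novackKernel_comm (ℓ γ : ℝ) (i j : d) : novackKernel ℓ γ i j = novackKernel ℓ γ j i := by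
  unfold novackKernel
  rw [novackKernelE_comm]

/-- The torus potential is **even**. [folklore] -/
theorem novackPotential_neg (ℓ γ : ℝ) (z : UnitAddTorus d) :
    novackPotential d ℓ γ (-z) = novackPotential d ℓ γ z :=
  periodize_neg_of_even (novackPotentialE_neg ℓ γ) z

/-- **Partial derivatives of a periodisation as a finite lattice sum**: for `g ∈ C¹` supported in
the closed ball of radius `R` and `n ≥ R + card d`,
`∂ᵢ(periodize g)(x) = ∑_{k ∈ window n} Dg(repr x + k) eᵢ`. [folklore] -/
theorem partialDeriv_periodize_eq_sum {g : EuclideanSpace ℝ d → ℝ} (hgs : ContDiff ℝ 1 g) {R : ℝ}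
    (hg : tsupport g ⊆ closedBall 0 R) {n : ℕ} (hn : R + Fintype.card d ≤ n) (i : d)
    (x : UnitAddTorus d) :
    FunctionSpaces.Torus.partialDeriv i (FunctionSpaces.Torus.periodize g) x =
      ∑ k ∈ FunctionSpaces.Torus.latticeWindow d n,
        fderiv ℝ g (FunctionSpaces.Torus.repr x + FunctionSpaces.Torus.latticeVec k)
          (EuclideanSpace.single i 1) := by
  have hx : ‖FunctionSpaces.Torus.repr x‖ ≤ Fintype.card d :=
    FunctionSpaces.Torus.norm_le_card_of_mem_unitCube (FunctionSpaces.Torus.repr_mem_unitCube x)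
  rw [FunctionSpaces.Torus.partialDeriv_eq_fderiv_apply
      (FunctionSpaces.Torus.isContDiff_periodize hgs hg),
    FunctionSpaces.Torus.fderiv_periodize' hgs hg,
    FunctionSpaces.Torus.perSum_eq_sum ((support_fderiv_subset ℝ).trans hg) hx hn,
    FunLike.coe_sum, Finset.sum_apply]

/-- **The divergence of the torus kernel is the gradient of the torus potential** (Novack 2024,
§2 Step 2, `∂ᵢ(T^{ik} φ) = ∂ₖ ζ̃`, periodised): for `0 < ℓ`, `0 < γ` and every `j`,
`∑ᵢ ∂ᵢ (novackKernel ℓ γ i j) = ∂ⱼ (novackPotential d ℓ γ)` on `T^d`. [cite: Novack2024, Sect. 2 Step 2, potentials ζ̃] -/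
theorem sum_partialDeriv_novackKernel (hℓ : 0 < ℓ) (hγ : 0 < γ) (j : d) (x : UnitAddTorus d) :
    ∑ i, FunctionSpaces.Torus.partialDeriv i (novackKernel ℓ γ i j) x =
      FunctionSpaces.Torus.partialDeriv j (novackPotential d ℓ γ) x := by
  obtain ⟨n, hn⟩ := exists_nat_ge (ℓ + Fintype.card d)
  unfold novackKernel novackPotential
  rw [partialDeriv_periodize_eq_sum ((contDiff_novackPotentialE ℓ γ).of_le (by simp))
    (tsupport_novackPotentialE_subset hℓ hγ) hn]
  simp_rw [partialDeriv_periodize_eq_sum ((contDiff_novackKernelE ℓ γ _ _).of_le (by simp))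
    (tsupport_novackKernelE_subset hℓ hγ _ _) hn]
  rw [Finset.sum_comm]
  exact Finset.sum_congr rfl fun k _ => sum_fderiv_novackKernelE ℓ γ j _

end TorusKernel

end Literature.Analysis.FluidPDE.Torus
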